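import Mathlib
import Summits.NavierStokesRegularity.NavierStokesRegularity.Theorems.TaoLadderRungThreeGappedFrontRobustTailEnergy
import Summits.NavierStokesRegularity.NavierStokesRegularity.Theorems.TaoLadderRungThreeGappedFrontRobustLipschitz
import HarnessLib

/-!
# `GappedFrontRobust`, the (step) clause: THE FRONT BLOCK AND THE SHELLS BEHIND IT, JOINTLY (a priori
  control of ONE flow on all shells below the tail WITHOUT the certificate's epoch envelope `env₀`;
  helper for item stmt-NavierStokesRegularity-22114 `GappedFrontRobustV2` / 20423)

HONEST FRAMING: a theorem about Tao-type MODEL lattice pseudo-flows (Tao 2016 §4 Lemma 4.1 (4.5), (4.8)–(4.9)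
with (4.3)) in the cell vocabulary `TaoCascade.PseudoFlowOn`; `bootstrap_family` (`…Comparison`) over the index
type `Option (Fin m × ℤ)` with the constant profile, combining the block energy inequality
(`…TailEnergy.pseudoFlowOn_block_energy_le`) for the finite FRONT BLOCK of shells `kb+1 … kt` with the
small-rate drift bound for the shells `≤ kb` BEHIND it. Nothing here concerns the Navier–Stokes equations;
nothing is asserted about any table.

WHY (K_B₂ architecture memo §7). The active-zone comparison needs an amplitude envelope of the EXACT flow,
uniform over ball starts. Format-v2 gap data bound the exact energies by `env₀` during the epoch, but a loose
`env₀` cannot make K_B₂ false, so the proof must produce its own envelope: far behind the front the flow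
cannot move (rates `(1+ε₀)^{5k/2}` vs tame data), and the finite front block only exchanges energy through
its two boundary bonds — with the behind shell `kb` (small rate) and with the first tail shell `kt+1`
(small amplitude, supplied by the tail zone as an implication from the block bound). The two parts are
each other's boundary, hence ONE joint bootstrap.

`pseudoFlowOn_block_and_behind`: hypotheses — start bounds `|S₀_{i,k}| ≤ G k` (k ≤ kb); block start energy
`≤ E₁/2`; envelope-of-neighbours `Ĝ` (`3 G k ≤ Ĝ n` for `k ≤ kb` among `n−1,n,n+1`, and `2√E₁ ≤ Ĝ kb`);
the tail implication `htop` (block energy `≤ 2E₁` on `[0,t]` ⇒ `|S_{i,kt+1}| ≤ Atop` on `[0,t]`); scalar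
smallness conditions for the behind drift (`τ · 2(∑|α|)(1+ε₀)^{5n/2} Ĝ n² ≤ G n/2`), the defect, and the two
boundary fluxes of the block (`τ·(in + out) ≤ E₁/2`); uniform Lipschitz bounds. Conclusion: on `[0, τ]`,
`|S_{i,n}(t) − S₀_{i,n}| ≤ G n` for every `n ≤ kb` AND block energy `∑_{k=kb+1}^{kt} ∑_i F_{i,k}(t) ≤ E₁`.
-/

noncomputable section

-- the sub-problem namespace `Summit.NavierStokesRegularity.NavierStokesRegularity` repeats the summit name by design (D-0017)
set_option linter.dupNamespace false

namespace Summit.NavierStokesRegularity.NavierStokesRegularity.Theorems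

open Set MeasureTheory intervalIntegral Literature.Analysis.FluidPDE Literature.Analysis.FluidPDE.TaoCascade

namespace GappedFrontRobust

variable {m : ℕ}
variable {τ ε₀ : ℝ} {α : Fin m → Fin m → Fin m → ℤ × ℤ × ℤ → ℝ} {κ₁ κ₂ : ℝ}
  {S₀ F₀ B₀ : Fin m → ℤ → ℝ} {S F : Fin m → ℤ → ℝ → ℝ}

/-- **Block improvement step** (one clock window, given bounds on `[0, t]`): the energy of the front block
`kb+1 … kb+Lb` at time `t` is at most its start value plus the two boundary fluxes integrated over `[0, t]`
(`pseudoFlowOn_block_energy_le`); these are small when the behind shell `kb` is tame (`|S_{·,kb}| ≤ Pb`), the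
first block shell is bounded (`≤ Q1`), the top block shell is energy-bounded (`≤ Etop`) and the first tail
shell is small (`≤ Atop`). [cite: Tao2016AveragedNS, §4 Lemma 4.1 (4.9) with (4.3)] -/
theorem pseudoFlowOn_block_improve (h : PseudoFlowOn τ ε₀ α κ₁ κ₂ S₀ F₀ B₀ S F) (hτ : 0 < τ)
    (hε : 0 < ε₀) (hα : IsCancellingCoeff α) (kb : ℤ) (Lb : ℕ)
    {Pb Q1 Atop Etop E₁ : ℝ} (hQ10 : 0 ≤ Q1) (hAtop0 : 0 ≤ Atop) (hEtop0 : 0 ≤ Etop)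
    {t : ℝ} (ht : t ∈ Icc 0 τ)
    (hblock0 : ∑ k ∈ Finset.range Lb, ∑ i, F₀ i (kb + 1 + k) ≤ E₁ / 2)
    (hPb : ∀ s ∈ Icc 0 t, ∀ i : Fin m, |S i kb s| ≤ Pb)
    (hQ1 : ∀ s ∈ Icc 0 t, ∀ i : Fin m, |S i (kb + 1) s| ≤ Q1)
    (hAtop : ∀ s ∈ Icc 0 t, ∀ i : Fin m, |S i (kb + Lb + 1) s| ≤ Atop)
    (hEtop : ∀ s ∈ Icc 0 t, ∑ i, F i (kb + Lb) s ≤ Etop)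
    (hcond : τ * ((1 + ε₀) ^ ((5 : ℝ) * kb / 2) * Pb ^ 2 * Q1 *
        (∑ i₁, ∑ i₂, ∑ i₃, |α i₁ i₂ i₃ (0, 0, 1)|) +
      2 * (1 + ε₀) ^ ((5 : ℝ) * ((kb + Lb : ℤ) : ℝ) / 2) * Atop *
        (∑ i₁, ∑ i₂, ∑ i₃, |α i₁ i₂ i₃ (0, 0, 1)|) * Etop) ≤ E₁ / 2) :
    ∑ k ∈ Finset.range Lb, ∑ i, F i (kb + 1 + k) t ≤ E₁ := by
  have hq : 0 < 1 + ε₀ := by linarith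
  set C : ℝ := ∑ i₁ : Fin m, ∑ i₂ : Fin m, ∑ i₃ : Fin m, |α i₁ i₂ i₃ (0, 0, 1)| with hC
  have hC0 : 0 ≤ C := Finset.sum_nonneg fun _ _ => Finset.sum_nonneg fun _ _ =>
    Finset.sum_nonneg fun _ _ => abs_nonneg _
  have htτ : Icc 0 t ⊆ Icc 0 τ := fun s hs => ⟨hs.1, hs.2.trans ht.2⟩
  have hsub : uIcc 0 t ⊆ Icc 0 τ := by rw [uIcc_of_le ht.1]; exact Icc_subset_Icc_right ht.2
  have hS : ∀ i n, ContinuousOn (S i n) (Icc 0 τ) := fun i n => (h.contDiffOn_S i n).continuousOn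
  have hbint : ∀ n : ℤ, IntervalIntegrable (fun s => botSum ε₀ α S n s) volume 0 t := fun n =>
    ((continuousOn_botSum ε₀ α hS n).mono hsub).intervalIntegrable
  have hblk := pseudoFlowOn_block_energy_le h hτ hα (kb + 1) Lb ht
  have hkt : kb + 1 + ((Lb : ℕ) : ℤ) - 1 = kb + Lb := by ring
  rw [show kb + 1 - 1 = kb by ring, hkt, intervalIntegral.integral_sub (hbint _) (hbint _)] at hblk
  -- pointwise flux bounds on [0, t]
  have hin : ∀ s ∈ Icc 0 t, |botSum ε₀ α S kb s| ≤ (1 + ε₀) ^ ((5 : ℝ) * kb / 2) * Pb ^ 2 * Q1 * C :=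
    fun s hs => abs_botSum_le_of_abs_le ε₀ hq α S kb s (hPb s hs) (hQ1 s hs)
  have hout : ∀ s ∈ Icc 0 t, |botSum ε₀ α S (kb + Lb) s| ≤
      2 * (1 + ε₀) ^ ((5 : ℝ) * ((kb + Lb : ℤ) : ℝ) / 2) * Atop * C * Etop := by
    intro s hs
    have hsτ := htτ hs
    have hb := abs_botSum_le_energy ε₀ hq α S F (kb + Lb) s (hAtop s hs)
      (fun i => h.nonneg_F i _ s hsτ) (fun i => h.defect_lower i _ s hsτ)
    have hc : 0 ≤ 2 * (1 + ε₀) ^ ((5 : ℝ) * ((kb + Lb : ℤ) : ℝ) / 2) * Atop * C := by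
      have := Real.rpow_pos_of_pos hq ((5 : ℝ) * ((kb + Lb : ℤ) : ℝ) / 2); positivity
    exact hb.trans (mul_le_mul_of_nonneg_left (hEtop s hs) hc)
  -- integrate the two fluxes
  set c1 : ℝ := (1 + ε₀) ^ ((5 : ℝ) * kb / 2) * Pb ^ 2 * Q1 * C with hc1
  set c2 : ℝ := 2 * (1 + ε₀) ^ ((5 : ℝ) * ((kb + Lb : ℤ) : ℝ) / 2) * Atop * C * Etop with hc2
  have hc10 : 0 ≤ c1 := by have := Real.rpow_pos_of_pos hq ((5 : ℝ) * kb / 2); positivity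
  have hc20 : 0 ≤ c2 := by
    have := Real.rpow_pos_of_pos hq ((5 : ℝ) * ((kb + Lb : ℤ) : ℝ) / 2); positivity
  have hI1' := intervalIntegral.norm_integral_le_of_norm_le_const (a := (0 : ℝ)) (b := t)
    (f := fun s => botSum ε₀ α S kb s) (C := c1) fun s hs => by
      rw [uIoc_of_le ht.1] at hs
      simpa only [Real.norm_eq_abs] using hin s ⟨hs.1.le, hs.2⟩
  have hI2' := intervalIntegral.norm_integral_le_of_norm_le_const (a := (0 : ℝ)) (b := t)
    (f := fun s => botSum ε₀ α S (kb + Lb) s) (C := c2) fun s hs => by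
      rw [uIoc_of_le ht.1] at hs
      simpa only [Real.norm_eq_abs] using hout s ⟨hs.1.le, hs.2⟩
  have hI1 : |∫ s in (0 : ℝ)..t, botSum ε₀ α S kb s| ≤ c1 * t := by
    simpa only [Real.norm_eq_abs, sub_zero, abs_of_nonneg ht.1] using hI1'
  have hI2 : |∫ s in (0 : ℝ)..t, botSum ε₀ α S (kb + Lb) s| ≤ c2 * t := by
    simpa only [Real.norm_eq_abs, sub_zero, abs_of_nonneg ht.1] using hI2'
  have hA1 := le_abs_self (∫ s in (0 : ℝ)..t, botSum ε₀ α S kb s)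
  have hA2 := neg_abs_le (∫ s in (0 : ℝ)..t, botSum ε₀ α S (kb + Lb) s)
  have ht1 : c1 * t ≤ c1 * τ := mul_le_mul_of_nonneg_left ht.2 hc10
  have ht2 : c2 * t ≤ c2 * τ := mul_le_mul_of_nonneg_left ht.2 hc20
  have hcond' : τ * (c1 + c2) ≤ E₁ / 2 := hcond
  linarith

/-- **Behind improvement step** (one shell `n`, given amplitude bounds `A ≥ 0` on all shells over `[0, t]`
with `A ≤ Ĝn` on the three neighbours of `n`): the drift `|S_{i,n}(t) − S₀_{i,n}|` is at most
`τ · 2(∑|α|)(1+ε₀)^{5n/2} Ĝn² +` the defect integral. [cite: Tao2016AveragedNS, §4 Lemma 4.1 (4.8)] -/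
theorem pseudoFlowOn_behind_improve (h : PseudoFlowOn τ ε₀ α κ₁ κ₂ S₀ F₀ B₀ S F) (hτ : 0 < τ)
    (hε : 0 ≤ ε₀) {t : ℝ} (ht : t ∈ Icc 0 τ) (i : Fin m) (n : ℤ) {A : ℤ → ℝ} {Ĝn : ℝ}
    (hA0 : ∀ k, 0 ≤ A k) (hAS : ∀ s ∈ Icc 0 t, ∀ (j : Fin m) (k : ℤ), |S j k s| ≤ A k)
    (h3 : ∀ k, n - 1 ≤ k → k ≤ n + 1 → A k ≤ Ĝn) :
    |S i n t - S₀ i n| ≤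
      τ * (2 * (∑ i₁, ∑ i₂, ∑ μ ∈ shiftSet, |α i₁ i₂ i μ|) * (1 + ε₀) ^ ((5 : ℝ) * n / 2) * Ĝn * Ĝn) +
        ∫ u in (0 : ℝ)..t, κ₁ * (1 + ε₀) ^ ((2 : ℝ) * n) * Real.sqrt (F i n u) := by
  have hqpt : ∀ s ∈ Icc 0 t, |quadTerm ε₀ α S i n s| ≤
      2 * (∑ i₁, ∑ i₂, ∑ μ ∈ shiftSet, |α i₁ i₂ i μ|) * (1 + ε₀) ^ ((5 : ℝ) * n / 2) * Ĝn * Ĝn := by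
    intro s hs
    have hb := abs_quadTerm_sub_quadTerm_le_of_le ε₀ hε α S (fun _ _ _ => (0 : ℝ)) i n s
      (A := A) (D := A) (Amax := Ĝn) (Dmax := Ĝn) (hAS s hs)
      (fun j k => by simpa using hA0 k) (fun j k => by simpa using hAS s hs j k) h3 h3
    rwa [quadTerm_zero_family, sub_zero] at hb
  have hsub : uIcc 0 t ⊆ Icc 0 τ := by
    rw [uIcc_of_le ht.1]; exact Icc_subset_Icc_right ht.2
  have hqint : IntervalIntegrable (fun s => quadTerm ε₀ α S i n s) volume 0 t :=
    ((pseudoFlowOn_continuousOn_quadTerm h i n).mono hsub).intervalIntegrable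
  set Q : ℝ := 2 * (∑ i₁, ∑ i₂, ∑ μ ∈ shiftSet, |α i₁ i₂ i μ|) * (1 + ε₀) ^ ((5 : ℝ) * n / 2) *
    Ĝn * Ĝn with hQ
  have hQ0 : 0 ≤ Q := (abs_nonneg _).trans (hqpt 0 ⟨le_rfl, ht.1⟩)
  have hI : |∫ s in (0 : ℝ)..t, quadTerm ε₀ α S i n s| ≤ τ * Q := by
    calc |∫ s in (0 : ℝ)..t, quadTerm ε₀ α S i n s|
        ≤ ∫ s in (0 : ℝ)..t, |quadTerm ε₀ α S i n s| :=
          intervalIntegral.abs_integral_le_integral_abs ht.1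
      _ ≤ ∫ s in (0 : ℝ)..t, Q :=
          intervalIntegral.integral_mono_on ht.1 hqint.abs (by simp) fun s hs => hqpt s hs
      _ = t * Q := by simp
      _ ≤ τ * Q := mul_le_mul_of_nonneg_right ht.2 hQ0
  have hmot := pseudoFlowOn_motion_integral h hτ i n ht
  have htri : |S i n t - S₀ i n| ≤
      |S i n t - S₀ i n - ∫ s in (0 : ℝ)..t, quadTerm ε₀ α S i n s| +
        |∫ s in (0 : ℝ)..t, quadTerm ε₀ α S i n s| := by
    have := abs_add_le (S i n t - S₀ i n - ∫ s in (0 : ℝ)..t, quadTerm ε₀ α S i n s)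
      (∫ s in (0 : ℝ)..t, quadTerm ε₀ α S i n s)
    simpa using this
  linarith

/-- **THE FRONT BLOCK AND THE SHELLS BEHIND IT, JOINTLY.** See the module docstring.
[cite: Tao2016AveragedNS, §4 Lemma 4.1 (4.5), (4.8)–(4.9) with (4.3); §6.2 Prop. 6.3 (viii)–(ix)] -/
theorem pseudoFlowOn_block_and_behind (h : PseudoFlowOn τ ε₀ α κ₁ κ₂ S₀ F₀ B₀ S F) (hτ : 0 < τ)
    (hε : 0 < ε₀) (hα : IsCancellingCoeff α) (kb : ℤ) (Lb : ℕ) (hLb : 1 ≤ Lb)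
    {G Ĝ : ℤ → ℝ} {E₁ Atop L : ℝ} (hG0 : ∀ k, 0 ≤ G k) (hE₁ : 0 < E₁) (hAtop : 0 ≤ Atop) (hL : 0 ≤ L)
    (hstart : ∀ (i : Fin m) (k : ℤ), k ≤ kb → |S₀ i k| ≤ G k)
    (hblock0 : ∑ k ∈ Finset.range Lb, ∑ i, F₀ i (kb + 1 + k) ≤ E₁ / 2)
    (hĜ : ∀ n : ℤ, n ≤ kb → ∀ k : ℤ, n - 1 ≤ k → k ≤ n + 1 → k ≤ kb → 3 * G k ≤ Ĝ n)
    (hĜb : 2 * Real.sqrt E₁ ≤ Ĝ kb)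
    (htop : ∀ t ∈ Icc 0 τ,
      (∀ u ∈ Icc 0 t, ∑ k ∈ Finset.range Lb, ∑ i, F i (kb + 1 + k) u ≤ 2 * E₁) →
        ∀ u ∈ Icc 0 t, ∀ i : Fin m, |S i (kb + 1 + Lb) u| ≤ Atop)
    (hcondBehind : ∀ (i : Fin m) (n : ℤ), n ≤ kb →
      τ * (2 * (∑ i₁, ∑ i₂, ∑ μ ∈ shiftSet, |α i₁ i₂ i μ|) * (1 + ε₀) ^ ((5 : ℝ) * n / 2) *
        Ĝ n * Ĝ n) ≤ G n / 2)
    (hdefBehind : ∀ (i : Fin m) (n : ℤ), n ≤ kb → ∀ t ∈ Icc 0 τ,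
      ∫ u in (0 : ℝ)..t, κ₁ * (1 + ε₀) ^ ((2 : ℝ) * n) * Real.sqrt (F i n u) ≤ G n / 2)
    (hcondBlock : τ * ((1 + ε₀) ^ ((5 : ℝ) * kb / 2) * Ĝ kb ^ 2 * (2 * Real.sqrt E₁) *
        (∑ i₁, ∑ i₂, ∑ i₃, |α i₁ i₂ i₃ (0, 0, 1)|) +
      2 * (1 + ε₀) ^ ((5 : ℝ) * ((kb + Lb : ℤ) : ℝ) / 2) * Atop *
        (∑ i₁, ∑ i₂, ∑ i₃, |α i₁ i₂ i₃ (0, 0, 1)|) * (2 * E₁)) ≤ E₁ / 2)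
    (hlipBehind : ∀ (i : Fin m) (n : ℤ), n ≤ kb → ∀ s ∈ Icc 0 τ, ∀ t ∈ Icc 0 τ,
      |S i n t - S i n s| ≤ L * G n * |t - s|)
    (hlipBlock : ∀ s ∈ Icc 0 τ, ∀ t ∈ Icc 0 τ,
      |∑ k ∈ Finset.range Lb, ∑ i, F i (kb + 1 + k) t -
        ∑ k ∈ Finset.range Lb, ∑ i, F i (kb + 1 + k) s| ≤ L * E₁ * |t - s|) :
    (∀ (i : Fin m) (n : ℤ), n ≤ kb → ∀ t ∈ Icc 0 τ, |S i n t - S₀ i n| ≤ G n) ∧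
      ∀ t ∈ Icc 0 τ, ∑ k ∈ Finset.range Lb, ∑ i, F i (kb + 1 + k) t ≤ E₁ := by
  have hq : 0 < 1 + ε₀ := by linarith
  obtain ⟨M, hM0, hM⟩ := pseudoFlowOn_uniform_bounds h hq
  -- the block energy and the family
  set Eb : ℝ → ℝ := fun t => ∑ k ∈ Finset.range Lb, ∑ i, F i (kb + 1 + k) t with hEb
  set u : Option (Fin m × ℤ) → ℝ → ℝ := fun j t =>
    j.elim (Eb t) (fun jk => if jk.2 ≤ kb then |S jk.1 jk.2 t - S₀ jk.1 jk.2| else 0) with hu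
  set p : Option (Fin m × ℤ) → ℝ := fun j => j.elim E₁ (fun jk => G jk.2) with hp
  have key := bootstrap_family (ι := Option (Fin m × ℤ)) (u := u) (p := p) (ψ := fun _ => (1 : ℝ))
    (τ := τ) (L := L) ?_ hL continuousOn_const (fun _ _ => one_pos) ?_ ?_ ?_
  · refine ⟨fun i n hn t ht => ?_, fun t ht => ?_⟩
    · have := key (some (i, n)) t ht
      simp only [hu, hp, Option.elim, hn, if_true, one_mul] at this
      exact this
    · have := key none t ht
      simp only [hu, hp, Option.elim, one_mul] at this
      exact this
  · rintro (_ | ⟨i, n⟩)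
    · simp only [hp, Option.elim]; exact hE₁.le
    · simp only [hp, Option.elim]; exact hG0 n
  · -- Lipschitz
    rintro (_ | ⟨i, n⟩) s hs t ht
    · simp only [hu, hp, Option.elim]; exact hlipBlock s hs t ht
    · by_cases hn : n ≤ kb
      · simp only [hu, hp, Option.elim, hn, if_true]
        refine (abs_abs_sub_abs_le_abs_sub _ _).trans ?_
        have heq : S i n t - S₀ i n - (S i n s - S₀ i n) = S i n t - S i n s := by ring
        rw [heq]; exact hlipBehind i n hn s hs t ht
      · simp only [hu, hp, Option.elim, hn, if_false, sub_self, abs_zero]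
        exact mul_nonneg (mul_nonneg hL (hG0 n)) (abs_nonneg _)
  · -- start
    rintro (_ | ⟨i, n⟩)
    · simp only [hu, hp, hEb, Option.elim, one_mul, h.init_F]
      linarith
    · by_cases hn : n ≤ kb
      · simp only [hu, hp, Option.elim, hn, if_true, h.init_S, sub_self, abs_zero, one_mul]; exact hG0 n
      · simp only [hu, hp, Option.elim, hn, if_false, one_mul]; exact hG0 n
  · -- improvement
    intro t ht hweak j
    have htτ : Icc 0 t ⊆ Icc 0 τ := fun s hs => ⟨hs.1, hs.2.trans ht.2⟩
    have hWbehind : ∀ s ∈ Icc 0 t, ∀ (i : Fin m) (k : ℤ), k ≤ kb → |S i k s| ≤ 3 * G k := by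
      intro s hs i k hk
      have hw := hweak (some (i, k)) s hs
      simp only [hu, hp, Option.elim, hk, if_true] at hw
      have hs0 := hstart i k hk
      have htri : |S i k s| ≤ |S i k s - S₀ i k| + |S₀ i k| := by
        have := abs_add_le (S i k s - S₀ i k) (S₀ i k); simpa using this
      linarith
    have hWblock : ∀ s ∈ Icc 0 t, Eb s ≤ 2 * E₁ := by
      intro s hs
      have hw := hweak none s hs
      simp only [hu, hp, Option.elim] at hw
      linarith
    have hshell : ∀ s ∈ Icc 0 t, ∀ k : ℕ, k < Lb → ∑ i, F i (kb + 1 + k) s ≤ 2 * E₁ := by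
      intro s hs k hk
      have h1 : ∑ i, F i (kb + 1 + k) s ≤ Eb s :=
        Finset.single_le_sum (f := fun k : ℕ => ∑ i, F i (kb + 1 + k) s)
          (fun k _ => Finset.sum_nonneg fun i _ => h.nonneg_F i _ s (htτ hs))
          (Finset.mem_range.mpr hk)
      exact h1.trans (hWblock s hs)
    have hamp1 : ∀ s ∈ Icc 0 t, ∀ i : Fin m, |S i (kb + 1) s| ≤ 2 * Real.sqrt E₁ := by
      intro s hs i
      have hsτ := htτ hs
      have h0 := hshell s hs 0 (by omega)
      simp only [Nat.cast_zero, add_zero] at h0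
      have h1 : F i (kb + 1) s ≤ ∑ j, F j (kb + 1) s :=
        Finset.single_le_sum (f := fun j => F j (kb + 1) s) (fun j _ => h.nonneg_F j _ s hsτ)
          (Finset.mem_univ i)
      have h2 := h.defect_lower i (kb + 1) s hsτ
      have h3 : S i (kb + 1) s ^ 2 ≤ (2 * Real.sqrt E₁) ^ 2 := by
        rw [mul_pow, Real.sq_sqrt hE₁.le]; linarith
      exact abs_le_of_sq_le_sq h3 (by positivity)
    have htopt := htop t ht (fun s hs => hWblock s hs)
    rcases j with _ | ⟨i, n⟩
    · -- the block member
      simp only [hu, hp, Option.elim, one_mul]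
      refine pseudoFlowOn_block_improve h hτ hε hα kb Lb (Pb := Ĝ kb) (Q1 := 2 * Real.sqrt E₁)
        (Atop := Atop) (Etop := 2 * E₁) (by positivity) hAtop (by linarith) ht hblock0
        (fun s hs i => (hWbehind s hs i kb le_rfl).trans
          (hĜ kb le_rfl kb (by linarith) (by linarith) le_rfl))
        hamp1 (fun s hs i => ?_) (fun s hs => ?_) hcondBlock
      · have := htopt s hs i
        rwa [show kb + 1 + (Lb : ℤ) = kb + Lb + 1 by ring] at this
      · obtain ⟨L', hL'⟩ : ∃ L' : ℕ, Lb = L' + 1 := ⟨Lb - 1, by omega⟩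
        have := hshell s hs L' (by omega)
        rwa [show kb + 1 + (L' : ℤ) = kb + Lb by rw [hL']; push_cast; ring] at this
    · -- a behind member
      by_cases hn : n ≤ kb
      swap
      · simp only [hu, hp, Option.elim, hn, if_false, one_mul]; exact hG0 n
      simp only [hu, hp, Option.elim, hn, if_true, one_mul]
      set A : ℤ → ℝ := fun k =>
        if k ≤ kb then 3 * G k else if k = kb + 1 then 2 * Real.sqrt E₁ else M with hA
      have hA0 : ∀ k, 0 ≤ A k := fun k => by
        simp only [hA]; split_ifs
        · exact mul_nonneg (by norm_num) (hG0 k)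
        · positivity
        · exact hM0
      have hAS : ∀ s ∈ Icc 0 t, ∀ (j : Fin m) (k : ℤ), |S j k s| ≤ A k := by
        intro s hs j k
        simp only [hA]
        split_ifs with hk hk'
        · exact hWbehind s hs j k hk
        · rw [hk']; exact hamp1 s hs j
        · exact (hM s (htτ hs) j k).1
      have h3 : ∀ k, n - 1 ≤ k → k ≤ n + 1 → A k ≤ Ĝ n := by
        intro k hk1 hk2
        simp only [hA]
        split_ifs with hk hk'
        · exact hĜ n hn k hk1 hk2 hk
        · have : n = kb := by omega
          rw [this]; exact hĜb
        · exfalso; omega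
      have hb := pseudoFlowOn_behind_improve h hτ hε.le ht i n hA0 hAS h3
      have hc := hcondBehind i n hn
      have hd := hdefBehind i n hn t ht
      linarith

end GappedFrontRobust

end Summit.NavierStokesRegularity.NavierStokesRegularity.Theorems

end
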